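import Summits.QuantumFields.YangMills.Theorems.BalabanUVNodesN15CurvedGluingCubeDressedGeneralGauge
import Summits.QuantumFields.YangMills.Theorems.BalabanUVNodesN15CurvedGluingCubeDefectGluing
import HarnessLib

/-!
# Route «BalabanUVNodes» (cluster K4 «SpineRates»), Track-A DAG node N15 = NE2, BACKGROUND LAYER — GLUING ACROSS PER-CUBE GAUGES: dag-n15-w3 file 32's gluing with locality defects
# (`hasMaj_glued_of_cutRows_defect`, `glued_inverse_of_defect`) when EVERY cube's parametrix is given IN ITS OWN GAUGE `W_□` ((3.35): the cube's small-field gauge) — the cut rows,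
# commutator rows, defect rows and the `hloc`-with-defect identities TRANSFER to the global gauge at the crude cost `|κ|²` (this seat's g4 `…DressedGeneralGauge`), so the glued
# operator built from the conjugated-back cubes `M_{W_□ᵀ}G′_□M_{W_□}` inverts the GLOBAL operator and decays: [B9] (3.87) with `G_□(U)` computed cube by cube in the (3.35) gauges

Cell `pub-ymgap`, seat `pub-ymgap-dag-n15-w2` (WIDTH SEAT 2∕3 on node N15, director-ym №197 ∕ HUMAN RULING D-0149), g5, seventh piece = dag-n15-w3 g4's located-unowned item (o1)
«per-cube GAUGE TRANSFER instantiated over files 34–45's hypothesis lists (n15-w2's p618904 road)», typed at the GENERIC level of file 32 (bus NOTICE I.38149, CLAIM-7).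
`bears_on: R4∕N15 · K3⁸ SpineGivenEndpointR13SepCoPHV (stmt-QuantumFields-27366)`.  Filed `--kind proof --supports stmt-QuantumFields-27366 --as helper` — COUNT-NEUTRAL.  Theorems only;
0 `def`, 0 `sorry`.  Imports BY NAME this seat's g4 `…CurvedGluingCubeDressedGeneralGauge` (`mulOp_comp_gaugeConj`, `transpose_gaugeConj_cancel`, `commOp_comp_gaugeConj`,
`hloc_defect_gaugeConj`, `hasMaj_gaugeConj_back`) and dag-n15-w3 file 32 `…CurvedGluingCubeDefectGluing` (`hasMaj_remainderD`, `glued_inverse_of_defect`, `hasMaj_glued_of_cutRows_defect`;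
through it n15-c's `parametrix`, `remainder`, `commOp`, `glueInv`); nothing in the tree is modified, no landed name re-declared.

WHY.  [Balaban1985BackgroundPropagators] (3.87) p. 409 glues `G′₀ = Σ_□ h_□G′_□h_□` from per-cube operators `G′_□(U)` which Corollary 3.6 p. 408 controls only AFTER the cube's
gauge transformation `u` of (3.35) («applying the gauge transformation u we get U′ = U^u = e^{iηA} with A satisfying the inequalities in (3.35) … we have to recall only that all the
results of these theorems are gauge invariant», (3.34) p. 396: `Δ(U^u) = R(u)Δ(U)R(u⁻¹)`, `G(U^u) = R(u)G(U)R(u⁻¹)`).  In the tree: file 32 glues a family `G_k` of local parametrices of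
ONE operator `Δ` with cut rows `hGc`, commutator rows `hK`, defect rows `hE` and identities `M_{h_k}ΔG_k = M_{h_k} + E_k`; the live-background cube device (files 23–45) produces such
rows for the species perturbation, whose letters are small only in the cube's own gauge (this seat's g5 FILES 1–6).  THIS FILE closes the loop at the generic level: with per-cube
orthogonal site gauges `W_k` and the LOCAL operators `Δ^{W_k} := M_{W_k}ΔM_{W_kᵀ}`, rows and identities proved for local parametrices `G′_k` of `Δ^{W_k}` yield file 32's
hypotheses for the GLOBAL family `G_k := M_{W_kᵀ}G′_kM_{W_k}`, `E_k := M_{W_kᵀ}E′_kM_{W_k}` with `β, θ₀, ε ↦ |κ|²β, |κ|²θ₀, |κ|²ε`: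
* §1 ★ `cutRow_of_localGauge` (`M_χG_k ≤ 1_S1_S·|κ|²β·e^{−δd}`), ★★ `commRow_of_localGauge` (`[Δ, M_h]G_k = M_{Wᵀ}([Δ^W, M_h]G′)M_W`, row `≤ 1_S(y′)·|κ|²θ₀·e^{−δd}`), ★ `defectRow_of_localGauge`,
  ★★ `hloc_defect_glue_of_localGauge` (`M_hΔ^WG′ = M_h + E′ ⟹ M_hΔG_k = M_h + E_k`);
* §2 ★★★ `hasMaj_glued_of_localGauges` (file 32's decay for the conjugated-back family: `𝒢 ≤ N_ov|κ|²β(1 − N_ov|κ|²(θ₀ + ε)c_r)⁻¹c_r·e^{−(δ−σ)d}`), ★★★ `glued_inverse_of_localGauges`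
  (`𝒢∘Δ = 1 ∧ Δ∘𝒢 = 1` for the GLOBAL `Δ` from the LOCAL identities, `Σh² = 1`, and the transferred remainder letter).

HONEST FRAMING ∕ LIMITS.  Finite-dimensional algebra + block-majorant bookkeeping over DISPLAYED per-cube rows ((3.34)–(3.35) p. 396, (3.87) p. 409 of [B9]; [Balaban1984PropagatorsII]
(2.91), (2.133)–(2.136) = SHAPES ∕ MECHANISM); the per-cube gauges `W_k`, the local parametrices and their rows are HYPOTHESES (producers: the (3.35) geometry ∕ this seat's FILES 3–4 for
`U(N)`, the cube device files 23–45, lane objects); one grid (the two-grid transfer needs the gauges' fit across grids, g4 `hasMaj_idef_gaugeConj` — not here); the cost `|κ|²` is the crude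
one of g4.  Nothing of [B5]∕[B6]∕[B9] asserted; NE2⁺ NOT PRINTED, NOT proved; N15 NOT discharged; K3⁸ OPEN, skeleton v6 untouched; counts of record UNMOVED (typed 28∕28 · discharged
5∕27 · A 5∕28); one finite 𝕋⁴ at fixed ε — NOT ℝ⁴ ∕ OS ∕ mass gap ∕ Clay; R4 closes the conditional finite-𝕋⁴ rung `BalabanLadder.UV` only.  Restate-immune (no Theses import).
-/

set_option autoImplicit false

noncomputable section
open scoped BigOperators Matrix
open Finset

namespace Summit.QuantumFields.YangMills.BalabanUVNodes.N15.CurvedSpecies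

open Literature.MathematicalPhysics.QuantumFieldTheory.Balaban1983to89
open Literature.MathematicalPhysics.QuantumFieldTheory.Balaban1983to89.B11SectG (BlockNorm HasMaj RowSum)
open Literature.MathematicalPhysics.QuantumFieldTheory.Balaban1983to89.B6RandomWalk (Triangle254)
open Literature.MathematicalPhysics.QuantumFieldTheory.Balaban1983to89.B6Prop26Gluing (mulOp ind ind_nonneg)
open Summit.QuantumFields.YangMills.BalabanUVNodes.N15.MatrixSpecies (mmulOp liftBlk)
open Summit.QuantumFields.YangMills.BalabanUVNodes.N15.Gluing (parametrix remainder commOp glueInv)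

variable {X : Type} [Fintype X] [DecidableEq X] {κ : Type} [Fintype κ] [DecidableEq κ] {K : Type} [Fintype K] {g : B6.Geometry} (blk : X → g.Site) (S : K → Set g.Site)
  (W : K → X → Matrix κ κ ℝ) (Δ : (X × κ → ℝ) →ₗ[ℝ] (X × κ → ℝ)) (hX χX : K → X → ℝ) (G' E' : K → (X × κ → ℝ) →ₗ[ℝ] (X × κ → ℝ))

/-! ## §1 The three row families and the `hloc` identities transfer from the cubes' gauges to the global gauge -/

section Rows

omit [Fintype X] [DecidableEq X] [Fintype K] in
/-- THE LOCAL OPERATOR READ BACK: `M_{Wᵀ}∘Δ^W∘M_W = Δ` for `Δ^W = M_W∘Δ∘M_{Wᵀ}`, `WᵀW = 1` (g4 `transpose_gaugeConj_cancel`). [cite: Balaban1985BackgroundPropagators, (3.34) p.396 (shape)] -/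
theorem localOp_conj_back (hW' : ∀ k x, (W k x)ᵀ * W k x = 1) (k : K) :
    mmulOp (fun x => (W k x)ᵀ) ∘ₗ (mmulOp (W k) ∘ₗ Δ ∘ₗ mmulOp (fun x => (W k x)ᵀ)) ∘ₗ mmulOp (W k) = Δ :=
  transpose_gaugeConj_cancel (W k) (hW' k) Δ

omit [DecidableEq X] [Fintype K] in
/-- ★ **CUT ROWS TRANSFER**: `M_χ∘G′ ≤ 1_S1_S·βe^{−δd}` in the cube's gauge ⟹ `M_χ∘(M_{Wᵀ}G′M_W) ≤ 1_S1_S·|κ|²β·e^{−δd}` (site cut-offs commute with the gauge action; g4 `hasMaj_gaugeConj_back`).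
[cite: Balaban1985BackgroundPropagators, (3.34)–(3.35) p.396, (3.42) p.397 (shapes)] -/
theorem cutRow_of_localGauge (hW : ∀ k x, W k x * (W k x)ᵀ = 1) (hW' : ∀ k x, (W k x)ᵀ * W k x = 1) {β δ : ℝ} (hβ : 0 ≤ β) (k : K)
    (hGc' : HasMaj (BlockNorm.ofBlocks g (liftBlk blk κ)) (BlockNorm.ofBlocks g (liftBlk blk κ)) (mulOp (fun p : X × κ => χX k p.1) ∘ₗ G' k)
      (fun y y' => ind (S k) y * ind (S k) y' * (β * Real.exp (-(δ * g.dist y y'))))) :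
    HasMaj (BlockNorm.ofBlocks g (liftBlk blk κ)) (BlockNorm.ofBlocks g (liftBlk blk κ))
      (mulOp (fun p : X × κ => χX k p.1) ∘ₗ (mmulOp (fun x => (W k x)ᵀ) ∘ₗ G' k ∘ₗ mmulOp (W k)))
      (fun y y' => ind (S k) y * ind (S k) y' * ((Fintype.card κ : ℝ) ^ 2 * β * Real.exp (-(δ * g.dist y y')))) := by
  have e := mulOp_comp_gaugeConj (fun x => (W k x)ᵀ) (χX k) (G' k)
  simp only [Matrix.transpose_transpose] at e
  rw [show (fun x => W k x) = W k from rfl] at e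
  rw [e]
  refine (hasMaj_gaugeConj_back blk (W k) (hW k) (hW' k) (fun y y' => ?_) hGc').mono fun y y' => le_of_eq (by ring)
  exact mul_nonneg (mul_nonneg (ind_nonneg _ y) (ind_nonneg _ y')) (mul_nonneg hβ (Real.exp_nonneg _))

omit [DecidableEq X] [Fintype K] in
/-- ★★ **COMMUTATOR ROWS TRANSFER**: the remainder's commutator `[Δ, M_h]∘(M_{Wᵀ}G′M_W)` IS `M_{Wᵀ}∘([Δ^W, M_h]∘G′)∘M_W` (`Δ = M_{Wᵀ}Δ^WM_W`, g4 `commOp_comp_gaugeConj`), so the local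
commutator row `[Δ^W, M_h]G′ ≤ 1_S(y′)·θ₀e^{−δd}` gives the global one with `|κ|²θ₀`. [cite: Balaban1984PropagatorsII, (2.93) p.239 (shape); Balaban1985BackgroundPropagators, (3.34) p.396] -/
theorem commRow_of_localGauge (hW : ∀ k x, W k x * (W k x)ᵀ = 1) (hW' : ∀ k x, (W k x)ᵀ * W k x = 1) {θ₀ δ : ℝ} (hθ : 0 ≤ θ₀) (k : K)
    (hK' : HasMaj (BlockNorm.ofBlocks g (liftBlk blk κ)) (BlockNorm.ofBlocks g (liftBlk blk κ))
      (commOp (mmulOp (W k) ∘ₗ Δ ∘ₗ mmulOp (fun x => (W k x)ᵀ)) (fun p : X × κ => hX k p.1) ∘ₗ G' k)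
      (fun y y' => ind (S k) y' * (θ₀ * Real.exp (-(δ * g.dist y y'))))) :
    HasMaj (BlockNorm.ofBlocks g (liftBlk blk κ)) (BlockNorm.ofBlocks g (liftBlk blk κ))
      (commOp Δ (fun p : X × κ => hX k p.1) ∘ₗ (mmulOp (fun x => (W k x)ᵀ) ∘ₗ G' k ∘ₗ mmulOp (W k)))
      (fun y y' => ind (S k) y' * ((Fintype.card κ : ℝ) ^ 2 * θ₀ * Real.exp (-(δ * g.dist y y')))) := by
  have hV' : ∀ x, ((W k x)ᵀ)ᵀ * (W k x)ᵀ = 1 := fun x => by rw [Matrix.transpose_transpose]; exact hW k x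
  have e := commOp_comp_gaugeConj (fun x => (W k x)ᵀ) hV' (hX k) (mmulOp (W k) ∘ₗ Δ ∘ₗ mmulOp (fun x => (W k x)ᵀ)) (G' k)
  simp only [Matrix.transpose_transpose] at e
  rw [show (fun x => W k x) = W k from rfl, localOp_conj_back W Δ hW' k] at e
  rw [e]
  refine (hasMaj_gaugeConj_back blk (W k) (hW k) (hW' k) (fun y y' => ?_) hK').mono fun y y' => le_of_eq (by ring)
  exact mul_nonneg (ind_nonneg _ y') (mul_nonneg hθ (Real.exp_nonneg _))

omit [DecidableEq X] [Fintype K] in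
/-- ★ **DEFECT ROWS TRANSFER**: `E′ ≤ 1_S(y)·εe^{−δd}` ⟹ `M_{Wᵀ}E′M_W ≤ 1_S(y)·|κ|²ε·e^{−δd}`. [cite: Balaban1985BackgroundPropagators, (3.34)–(3.35) p.396 (shapes)] -/
theorem defectRow_of_localGauge (hW : ∀ k x, W k x * (W k x)ᵀ = 1) (hW' : ∀ k x, (W k x)ᵀ * W k x = 1) {ε δ : ℝ} (hε : 0 ≤ ε) (k : K)
    (hE' : HasMaj (BlockNorm.ofBlocks g (liftBlk blk κ)) (BlockNorm.ofBlocks g (liftBlk blk κ)) (E' k) (fun y y' => ind (S k) y * (ε * Real.exp (-(δ * g.dist y y'))))) :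
    HasMaj (BlockNorm.ofBlocks g (liftBlk blk κ)) (BlockNorm.ofBlocks g (liftBlk blk κ)) (mmulOp (fun x => (W k x)ᵀ) ∘ₗ E' k ∘ₗ mmulOp (W k))
      (fun y y' => ind (S k) y * ((Fintype.card κ : ℝ) ^ 2 * ε * Real.exp (-(δ * g.dist y y')))) := by
  refine (hasMaj_gaugeConj_back blk (W k) (hW k) (hW' k) (fun y y' => ?_) hE').mono fun y y' => le_of_eq (by ring)
  exact mul_nonneg (ind_nonneg _ y) (mul_nonneg hε (Real.exp_nonneg _))

omit [Fintype X] [DecidableEq X] [Fintype K] in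
/-- ★★ **THE `hloc`-WITH-DEFECT IDENTITIES TRANSFER**: `M_h∘Δ^W∘G′ = M_h + E′` in the cube's gauge ⟹ `M_h∘Δ∘(M_{Wᵀ}G′M_W) = M_h + M_{Wᵀ}E′M_W` for the GLOBAL operator (g4
`hloc_defect_gaugeConj` read backwards; (3.34)). [cite: Balaban1985BackgroundPropagators, (3.34)–(3.35) p.396, (3.65) p.403 (shapes); Balaban1984PropagatorsII, (2.91) p.239] -/
theorem hloc_defect_glue_of_localGauge (hW : ∀ k x, W k x * (W k x)ᵀ = 1) (hW' : ∀ k x, (W k x)ᵀ * W k x = 1) (k : K)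
    (hloc' : mulOp (fun p : X × κ => hX k p.1) ∘ₗ (mmulOp (W k) ∘ₗ Δ ∘ₗ mmulOp (fun x => (W k x)ᵀ)) ∘ₗ G' k = mulOp (fun p : X × κ => hX k p.1) + E' k) :
    mulOp (fun p : X × κ => hX k p.1) ∘ₗ Δ ∘ₗ (mmulOp (fun x => (W k x)ᵀ) ∘ₗ G' k ∘ₗ mmulOp (W k)) =
      mulOp (fun p : X × κ => hX k p.1) + mmulOp (fun x => (W k x)ᵀ) ∘ₗ E' k ∘ₗ mmulOp (W k) := by
  have hV : ∀ x, (W k x)ᵀ * ((W k x)ᵀ)ᵀ = 1 := fun x => by rw [Matrix.transpose_transpose]; exact hW' k x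
  have hV' : ∀ x, ((W k x)ᵀ)ᵀ * (W k x)ᵀ = 1 := fun x => by rw [Matrix.transpose_transpose]; exact hW k x
  have h := hloc_defect_gaugeConj (fun x => (W k x)ᵀ) hV hV' hloc'
  simp only [Matrix.transpose_transpose] at h
  rw [show (fun x => W k x) = W k from rfl, localOp_conj_back W Δ hW' k] at h
  exact h

end Rows

/-! ## §2 File 32's gluing with the cubes given in their own gauges -/

section Glue

variable {σ cr : ℝ}

/-- ★★★ **THE GLUED OPERATOR BUILT FROM PER-CUBE-GAUGE PARAMETRICES DECAYS** — file 32 `hasMaj_glued_of_cutRows_defect` for the conjugated-back family `G_k := M_{W_kᵀ}G′_kM_{W_k}`,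
`E_k := M_{W_kᵀ}E′_kM_{W_k}`, all three row families given IN THE CUBES' GAUGES (cut rows of `G′_k`, commutator rows of `[Δ^{W_k}, M_{h_k}]G′_k`, defect rows of `E′_k`):
`𝒢 = glueInv (Σ_kM_{h_k}G_kM_{h_k}) (R − Σ_kE_kM_{h_k}) ≤ N_ov|κ|²β(1 − N_ov(|κ|²θ₀ + |κ|²ε)c_r)⁻¹c_r·e^{−(δ−σ)d}`.
[cite: Balaban1985BackgroundPropagators, (3.34)–(3.35) p.396, (3.87) p.409 (shapes ∕ mechanism); Balaban1984PropagatorsII, (2.91) p.239, (2.133)–(2.136) p.247] -/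
theorem hasMaj_glued_of_localGauges (htri : Triangle254 g) (hd : ∀ a b : g.Site, 0 ≤ g.dist a b) (hd0 : ∀ y : g.Site, g.dist y y = 0) (hrow : RowSum g σ cr) (hσ : 0 ≤ σ)
    (hW : ∀ k x, W k x * (W k x)ᵀ = 1) (hW' : ∀ k x, (W k x)ᵀ * W k x = 1) {β θ₀ ε δ Nov : ℝ} (hβ : 0 ≤ β) (hθ : 0 ≤ θ₀) (hε : 0 ≤ ε) (hNov : 0 ≤ Nov) (hσδ : 2 * σ ≤ δ)
    (hcut : ∀ k, mulOp (fun p : X × κ => hX k p.1) ∘ₗ mulOp (fun p : X × κ => χX k p.1) = mulOp (fun p : X × κ => hX k p.1)) (hh : ∀ k p, |(fun p : X × κ => hX k p.1) p| ≤ 1)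
    (hN : ∀ a, ∑ k, ind (S k) a ≤ Nov)
    (hGc' : ∀ k, HasMaj (BlockNorm.ofBlocks g (liftBlk blk κ)) (BlockNorm.ofBlocks g (liftBlk blk κ)) (mulOp (fun p : X × κ => χX k p.1) ∘ₗ G' k)
      (fun y y' => ind (S k) y * ind (S k) y' * (β * Real.exp (-(δ * g.dist y y')))))
    (hK' : ∀ k, HasMaj (BlockNorm.ofBlocks g (liftBlk blk κ)) (BlockNorm.ofBlocks g (liftBlk blk κ))
      (commOp (mmulOp (W k) ∘ₗ Δ ∘ₗ mmulOp (fun x => (W k x)ᵀ)) (fun p : X × κ => hX k p.1) ∘ₗ G' k) (fun y y' => ind (S k) y' * (θ₀ * Real.exp (-(δ * g.dist y y')))))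
    (hE' : ∀ k, HasMaj (BlockNorm.ofBlocks g (liftBlk blk κ)) (BlockNorm.ofBlocks g (liftBlk blk κ)) (E' k) (fun y y' => ind (S k) y * (ε * Real.exp (-(δ * g.dist y y')))))
    (hq : Nov * ((Fintype.card κ : ℝ) ^ 2 * θ₀ + (Fintype.card κ : ℝ) ^ 2 * ε) * cr < 1) :
    HasMaj (BlockNorm.ofBlocks g (liftBlk blk κ)) (BlockNorm.ofBlocks g (liftBlk blk κ))
      (glueInv (parametrix (fun k => fun p : X × κ => hX k p.1) (fun k => mmulOp (fun x => (W k x)ᵀ) ∘ₗ G' k ∘ₗ mmulOp (W k)))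
        (remainder Δ (fun k => fun p : X × κ => hX k p.1) (fun k => mmulOp (fun x => (W k x)ᵀ) ∘ₗ G' k ∘ₗ mmulOp (W k)) -
          ∑ k, (mmulOp (fun x => (W k x)ᵀ) ∘ₗ E' k ∘ₗ mmulOp (W k)) ∘ₗ mulOp (fun p : X × κ => hX k p.1)))
      (fun y y' => Nov * ((Fintype.card κ : ℝ) ^ 2 * β) * (1 - Nov * ((Fintype.card κ : ℝ) ^ 2 * θ₀ + (Fintype.card κ : ℝ) ^ 2 * ε) * cr)⁻¹ * cr *
        Real.exp (-((δ - σ) * g.dist y y'))) :=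
  hasMaj_glued_of_cutRows_defect (liftBlk blk κ) S htri hd hd0 hrow hσ (by positivity) (by positivity) (by positivity) hNov hσδ hcut hh hN
    (fun k => cutRow_of_localGauge blk S W χX G' hW hW' hβ k (hGc' k)) (fun k => commRow_of_localGauge blk S W Δ hX G' hW hW' hθ k (hK' k))
    (fun k => defectRow_of_localGauge blk S W E' hW hW' hε k (hE' k)) hq

/-- ★★★ **… AND IT IS A TWO-SIDED INVERSE OF THE GLOBAL OPERATOR** — file 32 `glued_inverse_of_defect` with the `hloc` identities, the commutator rows and the defect rows given IN THE
CUBES' GAUGES: `Σ_kh_k² = 1`, `M_{h_k}Δ^{W_k}G′_k = M_{h_k} + E′_k`, rows as in `hasMaj_glued_of_localGauges`, `N_ov|κ|²(θ₀ + ε)c_r < 1`, `σ ≤ δ` ⟹ `𝒢∘Δ = 1 ∧ Δ∘𝒢 = 1`.  Each cube may be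
computed in its own (3.35) gauge; the glued operator inverts `Δ(U)` in the global gauge. [cite: Balaban1985BackgroundPropagators, (3.34)–(3.35) p.396, (3.87) p.409, Cor. 3.6 p.408 (mechanism); Balaban1984PropagatorsII, (2.91) p.239, (2.135)–(2.136) p.247] -/
theorem glued_inverse_of_localGauges (hd : ∀ a b : g.Site, 0 ≤ g.dist a b) (hrow : RowSum g σ cr) (hW : ∀ k x, W k x * (W k x)ᵀ = 1) (hW' : ∀ k x, (W k x)ᵀ * W k x = 1)
    {θ₀ ε δ Nov : ℝ} (hθ : 0 ≤ θ₀) (hε : 0 ≤ ε) (hNov : 0 ≤ Nov) (hσδ : σ ≤ δ) (h236 : ∀ p : X × κ, ∑ k, (fun p : X × κ => hX k p.1) p ^ 2 = 1)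
    (hh : ∀ k p, |(fun p : X × κ => hX k p.1) p| ≤ 1) (hN : ∀ a, ∑ k, ind (S k) a ≤ Nov)
    (hloc' : ∀ k, mulOp (fun p : X × κ => hX k p.1) ∘ₗ (mmulOp (W k) ∘ₗ Δ ∘ₗ mmulOp (fun x => (W k x)ᵀ)) ∘ₗ G' k = mulOp (fun p : X × κ => hX k p.1) + E' k)
    (hK' : ∀ k, HasMaj (BlockNorm.ofBlocks g (liftBlk blk κ)) (BlockNorm.ofBlocks g (liftBlk blk κ))
      (commOp (mmulOp (W k) ∘ₗ Δ ∘ₗ mmulOp (fun x => (W k x)ᵀ)) (fun p : X × κ => hX k p.1) ∘ₗ G' k) (fun y y' => ind (S k) y' * (θ₀ * Real.exp (-(δ * g.dist y y')))))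
    (hE' : ∀ k, HasMaj (BlockNorm.ofBlocks g (liftBlk blk κ)) (BlockNorm.ofBlocks g (liftBlk blk κ)) (E' k) (fun y y' => ind (S k) y * (ε * Real.exp (-(δ * g.dist y y')))))
    (hq : Nov * ((Fintype.card κ : ℝ) ^ 2 * θ₀ + (Fintype.card κ : ℝ) ^ 2 * ε) * cr < 1) :
    glueInv (parametrix (fun k => fun p : X × κ => hX k p.1) (fun k => mmulOp (fun x => (W k x)ᵀ) ∘ₗ G' k ∘ₗ mmulOp (W k)))
        (remainder Δ (fun k => fun p : X × κ => hX k p.1) (fun k => mmulOp (fun x => (W k x)ᵀ) ∘ₗ G' k ∘ₗ mmulOp (W k)) -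
          ∑ k, (mmulOp (fun x => (W k x)ᵀ) ∘ₗ E' k ∘ₗ mmulOp (W k)) ∘ₗ mulOp (fun p : X × κ => hX k p.1)) ∘ₗ Δ = LinearMap.id ∧
      Δ ∘ₗ glueInv (parametrix (fun k => fun p : X × κ => hX k p.1) (fun k => mmulOp (fun x => (W k x)ᵀ) ∘ₗ G' k ∘ₗ mmulOp (W k)))
        (remainder Δ (fun k => fun p : X × κ => hX k p.1) (fun k => mmulOp (fun x => (W k x)ᵀ) ∘ₗ G' k ∘ₗ mmulOp (W k)) -
          ∑ k, (mmulOp (fun x => (W k x)ᵀ) ∘ₗ E' k ∘ₗ mmulOp (W k)) ∘ₗ mulOp (fun p : X × κ => hX k p.1)) = LinearMap.id :=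
  glued_inverse_of_defect (liftBlk blk κ) hd hrow (mul_nonneg hNov (by positivity)) hσδ h236 (fun k => hloc_defect_glue_of_localGauge W Δ hX G' E' hW hW' k (hloc' k))
    (hasMaj_remainderD (liftBlk blk κ) S (by positivity) (by positivity) hh hN (fun k => commRow_of_localGauge blk S W Δ hX G' hW hW' hθ k (hK' k))
      (fun k => defectRow_of_localGauge blk S W E' hW hW' hε k (hE' k))) hq

end Glue

end Summit.QuantumFields.YangMills.BalabanUVNodes.N15.CurvedSpecies

end
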